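import Summits.QuantumFields.YangMills.Theorems.BalabanUVNodesN19TriangleWaveBessel
import Literature.Analysis.SpecialFunctions.TanhPartialFractions
import Mathlib.MeasureTheory.Integral.DominatedConvergence

/-!
# YM-DAG node N19 (= NE7 proper) — FIXED OBSERVABLES UNDER THE UNIFORM-MOMENT CURRENCY, II: THE SQUARE-FUNCTION BOUND for the triangle waves
# `arccos(cos(n·))` — `Σ_n (1∕n)|∫_0^π f(θ)(arccos(cos nθ) − π∕2)dθ| ≤ (π³∕6)·sup|f|`

Cell `pub-ymgap`, HUMAN RULING D-0062 (Track A) ∕ D-0149 (work-bound push), R141 (C) wider-strategy seat `pub-ymgap-dag-n19-e` (strategy s3 =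
ALTERNATIVE CURRENCY), generation g24, module 2 (lineage module 86; part I = module 85 `…N19TriangleWaveBessel`, part III = module 87
`…N19FixedTestArcChains`).  Route `Summits/QuantumFields/YangMills/Theses/BalabanUVNodes.lean` rev 25, cluster item K3⁷ «SpineGivenEndpointR13SepCoPH»
(stmt-QuantumFields-20544); filed `--supports` that item `--as helper` (it proves no registered stub).  COUNT-NEUTRAL: [folklore] real analysis over
Mathlib (dominated convergence for series of interval integrals `intervalIntegral.hasSum_integral_of_dominated_convergence`, `norm_tsum_le_tsum_norm`,
`Summable.tsum_finsetSum`, `hasSum_zeta_two`) + part I and the tree's `Literature.Analysis.SpecialFunctions.hasSum_one_div_odd_sq`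
(`Σ 1∕(2k+1)² = π²∕8`, `TanhPartialFractions`) BY NAME; no scheme object, no Theses import; NOT a discharge claim.

THE BOUND.  For a measurable `f : ℝ → ℝ` with `|f| ≤ M` (`M > 0`) write `T_n(f) = ∫_0^π f(θ)(arccos(cos(nθ)) − π∕2)dθ` (the integral of `f` against the
CENTRED TRIANGLE WAVE with `n` teeth).  Trivially `|T_n| ≤ (π²∕2)M`, so `Σ_n |T_n|∕n` could diverge logarithmically; it does NOT:
★★ `sum_div_abs_integral_mul_triangle_le`: `Σ_{n<N} (1∕(n+1))|T_{n+1}(f)| ≤ (π³∕6)·M` for every `N` (and the summable ∕ `tsum` forms).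
PROOF (the square-function argument).  Part I §3 expands the triangle wave in ODD harmonics, `arccos(cos(nθ)) − π∕2 = −(4∕π)Σ_i cos((2i+1)nθ)∕(2i+1)²`,
uniformly; dominated convergence (majorant `M∕(2i+1)²`) integrates term by term: `T_n(f) = −(4∕π)Σ_i c_{(2i+1)n}(f)∕(2i+1)²` with the cosine
coefficients `c_m(f) = ∫_0^π f cos(m·)`.  Exchange the finite `n`-sum with the `i`-series; for each odd `l = 2i+1` the map `n ↦ l(n+1)` is injective, so
BESSEL (part I §2) gives `Σ_{n<N} c_{l(n+1)}² ≤ Σ_m c_m² ≤ (π²∕2)M²`, and `|c|∕(n+1) ≤ ½(c²∕M + M∕(n+1)²)` with `Σ 1∕(n+1)² ≤ π²∕6` yields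
`Σ_{n<N} |c_{l(n+1)}|∕(n+1) ≤ (π²∕3)M` FOR EVERY `l`; finally `Σ_i 1∕(2i+1)² = π²∕8` (the tree's `hasSum_one_div_odd_sq`) and `(4∕π)(π²∕8)(π²∕3) = π³∕6`.
USE (module 87).  With `f = F′`, `F(θ) = G(cos θ)sin θ` for a `K`-Lipschitz `B`-bounded test `G` on `[−1,1]`, `(1∕n)T_n(F′)` is (minus) the level-`n`
alternating Chebyshev-arc functional of `G` (one integration by parts), so the functionals are absolutely summable over the levels, `≤ (π³∕6)(K+B)`:
every FIXED Lipschitz observable rides the uniform-moment arc chains of modules 78∕79 with ABSOLUTELY summable increments.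

HONEST FRAMING (binding).  Elementary and [folklore]; no law, no scheme object; NO consumer in the DAG today (a structural statement about the seat's own
currencies); nothing of Bałaban's instantiated; NE7 NOT PRINTED, NOT proved; N19 NOT discharged; count-neutral.  One finite `T⁴` programme at fixed `ε`;
nothing continuum ∕ `ℝ⁴` ∕ OS ∕ mass-gap ∕ Clay.  0 `def` ∕ 0 `sorry`.
-/

noncomputable section

open Real Finset MeasureTheory

namespace Summit.QuantumFields.YangMills.Theorems.BalabanUVNodesN19TriangleWaveSquareFunction

open Summit.QuantumFields.YangMills.Theorems.BalabanUVNodesN19TriangleWaveBessel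
open Literature.Analysis.SpecialFunctions (hasSum_one_div_odd_sq)

/-! ## §1 Term-by-term integration of the odd cosine series [folklore] -/

/-- `Σ_{n<N} 1∕(n+1)² ≤ π²∕6`. [folklore] -/
theorem sum_one_div_succ_sq_le (N : ℕ) : ∑ n ∈ Finset.range N, 1 / ((n : ℝ) + 1) ^ 2 ≤ π ^ 2 / 6 := by
  have h := sum_le_hasSum (Finset.range (N + 1)) (fun m _ => by positivity) hasSum_zeta_two
  rw [Finset.sum_range_succ'] at h
  push_cast at h
  simpa using h

/-- Term-by-term integration of the odd cosine series against a bounded measurable `f` (dominated convergence, majorant `M∕(2i+1)²`):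
`Σ_i ∫_0^π f(θ)cos((2i+1)aθ)∕(2i+1)² dθ = ∫_0^π f(θ)(π²∕8 − (π∕4)arccos(cos(aθ)))dθ`. [folklore] -/
theorem hasSum_integral_mul_cos_odd {f : ℝ → ℝ} {M : ℝ} (hf : Measurable f) (hb : ∀ θ, |f θ| ≤ M) (a : ℝ) :
    HasSum (fun i : ℕ => ∫ θ in (0 : ℝ)..π, f θ * (Real.cos ((2 * i + 1) * (a * θ)) / (2 * i + 1) ^ 2))
      (∫ θ in (0 : ℝ)..π, f θ * (π ^ 2 / 8 - π / 4 * Real.arccos (Real.cos (a * θ)))) := by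
  refine intervalIntegral.hasSum_integral_of_dominated_convergence
    (bound := fun i _ => M * (1 / (2 * (i : ℝ) + 1) ^ 2)) (fun i => ?_) (fun i => ?_) ?_ ?_ ?_
  · exact (hf.mul ((Real.continuous_cos.comp (continuous_const.mul (continuous_const.mul continuous_id))).measurable.div_const _)).aestronglyMeasurable
  · refine Filter.Eventually.of_forall fun θ _ => ?_
    rw [Real.norm_eq_abs, abs_mul, abs_div, abs_of_pos (by positivity : (0 : ℝ) < (2 * i + 1) ^ 2)]
    exact mul_le_mul (hb θ) (div_le_div_of_nonneg_right (Real.abs_cos_le_one _) (by positivity)) (by positivity)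
      ((abs_nonneg _).trans (hb θ))
  · exact Filter.Eventually.of_forall fun θ _ => hasSum_one_div_odd_sq.summable.mul_left M
  · exact intervalIntegrable_const
  · exact Filter.Eventually.of_forall fun θ _ => (hasSum_odd_cos_div_sq_arccos_cos (a * θ)).mul_left (f θ)

/-- The integral against the centred triangle wave as an odd-harmonic series of cosine coefficients:
`∫_0^π f(θ)(arccos(cos(aθ)) − π∕2)dθ = −(4∕π)Σ_i c_{(2i+1)a}∕(2i+1)²`, `c_m = ∫_0^π f(θ)cos(mθ)dθ`. [folklore] -/
theorem integral_mul_triangle_eq_tsum {f : ℝ → ℝ} {M : ℝ} (hf : Measurable f) (hb : ∀ θ, |f θ| ≤ M) (a : ℝ) :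
    ∫ θ in (0 : ℝ)..π, f θ * (Real.arccos (Real.cos (a * θ)) - π / 2) =
      -(4 / π) * ∑' i : ℕ, (∫ θ in (0 : ℝ)..π, f θ * Real.cos ((2 * i + 1) * (a * θ))) / (2 * i + 1) ^ 2 := by
  have h := (hasSum_integral_mul_cos_odd hf hb a).tsum_eq
  have e1 : ∀ i : ℕ, ∫ θ in (0 : ℝ)..π, f θ * (Real.cos ((2 * i + 1) * (a * θ)) / (2 * i + 1) ^ 2) =
      (∫ θ in (0 : ℝ)..π, f θ * Real.cos ((2 * i + 1) * (a * θ))) / (2 * i + 1) ^ 2 := fun i => by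
    rw [← intervalIntegral.integral_div]
    exact intervalIntegral.integral_congr fun θ _ => by ring
  have e2 : ∫ θ in (0 : ℝ)..π, f θ * (π ^ 2 / 8 - π / 4 * Real.arccos (Real.cos (a * θ))) =
      -(π / 4) * ∫ θ in (0 : ℝ)..π, f θ * (Real.arccos (Real.cos (a * θ)) - π / 2) := by
    rw [← intervalIntegral.integral_const_mul]
    exact intervalIntegral.integral_congr fun θ _ => by ring
  simp_rw [e1] at h
  rw [e2] at h
  have hπ := Real.pi_pos
  rw [h, ← mul_assoc, show -(4 / π) * (-(π / 4)) = (1 : ℝ) by field_simp, one_mul]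

/-- The cosine coefficients of a bounded `f` are bounded: `|∫_0^π f cos(m·)| ≤ πM`. [bookkeeping] -/
theorem abs_integral_mul_cos_le {f : ℝ → ℝ} {M : ℝ} (hb : ∀ θ, |f θ| ≤ M) (b : ℝ) :
    |∫ θ in (0 : ℝ)..π, f θ * Real.cos (b * θ)| ≤ π * M := by
  have h := intervalIntegral.norm_integral_le_of_norm_le_const (a := 0) (b := π) (C := M)
    (f := fun θ => f θ * Real.cos (b * θ)) fun θ _ => by
      rw [Real.norm_eq_abs, abs_mul]
      exact (mul_le_of_le_one_right (abs_nonneg _) (Real.abs_cos_le_one _)).trans (hb θ)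
  rw [Real.norm_eq_abs, sub_zero, abs_of_pos Real.pi_pos] at h
  linarith

/-- One level: `|∫_0^π f(θ)(arccos(cos(aθ)) − π∕2)dθ| ≤ (4∕π)Σ_i |c_{(2i+1)a}|∕(2i+1)²`. [folklore] -/
theorem abs_integral_mul_triangle_le_tsum {f : ℝ → ℝ} {M : ℝ} (hf : Measurable f) (hb : ∀ θ, |f θ| ≤ M) (a : ℝ) :
    |∫ θ in (0 : ℝ)..π, f θ * (Real.arccos (Real.cos (a * θ)) - π / 2)| ≤
      4 / π * ∑' i : ℕ, |∫ θ in (0 : ℝ)..π, f θ * Real.cos ((2 * i + 1) * (a * θ))| / (2 * i + 1) ^ 2 := by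
  have hsum : Summable fun i : ℕ => |∫ θ in (0 : ℝ)..π, f θ * Real.cos ((2 * i + 1) * (a * θ))| / (2 * i + 1) ^ 2 := by
    refine Summable.of_nonneg_of_le (fun i => by positivity) (fun i => ?_) ((hasSum_one_div_odd_sq.summable.mul_left (π * M)))
    rw [div_eq_mul_one_div]
    refine mul_le_mul_of_nonneg_right ?_ (by positivity)
    have := abs_integral_mul_cos_le hb ((2 * i + 1) * a)
    refine le_trans (le_of_eq ?_) this
    congr 1
    exact intervalIntegral.integral_congr fun θ _ => by rw [mul_assoc]
  rw [integral_mul_triangle_eq_tsum hf hb a, abs_mul, abs_neg, abs_of_pos (by positivity : (0 : ℝ) < 4 / π)]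
  refine mul_le_mul_of_nonneg_left ?_ (by positivity)
  have h := norm_tsum_le_tsum_norm (f := fun i : ℕ =>
    (∫ θ in (0 : ℝ)..π, f θ * Real.cos ((2 * i + 1) * (a * θ))) / (2 * i + 1) ^ 2) ?_
  · simp only [Real.norm_eq_abs] at h
    refine h.trans (le_of_eq (tsum_congr fun i => ?_))
    rw [abs_div, abs_of_pos (by positivity : (0 : ℝ) < (2 * i + 1) ^ 2)]
  · simp only [Real.norm_eq_abs]
    refine hsum.congr fun i => ?_
    rw [abs_div, abs_of_pos (by positivity : (0 : ℝ) < (2 * i + 1) ^ 2)]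

/-! ## §2 The square-function bound [folklore] -/

/-- ★★ **THE SQUARE-FUNCTION BOUND.**  For a measurable `f` with `|f| ≤ M` (`M > 0`) and every `N`:
`Σ_{n<N} (1∕(n+1))·|∫_0^π f(θ)(arccos(cos((n+1)θ)) − π∕2)dθ| ≤ (π³∕6)·M`.
Odd-harmonic expansion (§3–§4), exchange of the two sums, and for each odd `l`: `|c_{l(n+1)}|∕(n+1) ≤ ½(c_{l(n+1)}²∕M + M∕(n+1)²)` with
BESSEL `Σ_n c_{l(n+1)}² ≤ Σ_m c_m² ≤ (π²∕2)M²` (§2; `n ↦ l(n+1)` injective) and `Σ 1∕(n+1)² ≤ π²∕6`; then `Σ_l 1∕l² = π²∕8`. [folklore] -/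
theorem sum_div_abs_integral_mul_triangle_le {f : ℝ → ℝ} {M : ℝ} (hf : Measurable f) (hM : 0 < M)
    (hb : ∀ θ, |f θ| ≤ M) (N : ℕ) :
    ∑ n ∈ Finset.range N, 1 / ((n : ℝ) + 1) *
        |∫ θ in (0 : ℝ)..π, f θ * (Real.arccos (Real.cos (((n : ℝ) + 1) * θ)) - π / 2)| ≤ π ^ 3 / 6 * M := by
  -- the cosine coefficients at integer frequencies `m + 1`
  set c : ℕ → ℝ := fun m => ∫ θ in (0 : ℝ)..π, f θ * Real.cos (((m : ℝ) + 1) * θ) with hc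
  obtain ⟨-, hBessel⟩ := summable_sq_cosCoeff hf hb
  -- the coefficient at frequency `(2i+1)(n+1)` is `c (2i(n+1) + n)`
  have hfreq : ∀ i n : ℕ, ∫ θ in (0 : ℝ)..π, f θ * Real.cos ((2 * i + 1) * (((n : ℝ) + 1) * θ)) = c (2 * i * (n + 1) + n) := by
    intro i n
    simp only [hc]
    refine intervalIntegral.integral_congr fun θ _ => ?_
    push_cast
    ring_nf
  -- AM–GM
  have hamgm : ∀ (x y : ℝ), 0 < y → x / y ≤ (x ^ 2 / M + M / y ^ 2) / 2 := fun x y hy => by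
    have h : (x ^ 2 / M + M / y ^ 2) / 2 - x / y = (x * y - M) ^ 2 / (2 * M * y ^ 2) := by
      field_simp
      ring
    have h2 : 0 ≤ (x * y - M) ^ 2 / (2 * M * y ^ 2) := by positivity
    linarith
  -- the inner sums, one odd harmonic `l = 2i+1` at a time
  have hinner : ∀ i : ℕ, ∑ n ∈ Finset.range N, |c (2 * i * (n + 1) + n)| / ((n : ℝ) + 1) ≤ π ^ 2 / 3 * M := by
    intro i
    have h1 : ∑ n ∈ Finset.range N, |c (2 * i * (n + 1) + n)| / ((n : ℝ) + 1) ≤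
        ∑ n ∈ Finset.range N, ((c (2 * i * (n + 1) + n)) ^ 2 / M + M / ((n : ℝ) + 1) ^ 2) / 2 :=
      Finset.sum_le_sum fun n _ => (hamgm _ _ (by positivity)).trans (by rw [sq_abs])
    have h2 : ∑ n ∈ Finset.range N, (c (2 * i * (n + 1) + n)) ^ 2 ≤ π ^ 2 / 2 * M ^ 2 := by
      -- reindex by the injective `n ↦ 2i(n+1) + n` into `range ((2i+1)(N+1))`
      have hinj : Set.InjOn (fun n : ℕ => 2 * i * (n + 1) + n) (Finset.range N) := fun x _ y _ h => by
        have : (2 * i + 1) * x = (2 * i + 1) * y := by ring_nf; ring_nf at h; omega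
        exact Nat.eq_of_mul_eq_mul_left (by omega) this
      rw [← Finset.sum_image (f := fun m => c m ^ 2) hinj]
      refine (Finset.sum_le_sum_of_subset_of_nonneg ?_ fun m _ _ => sq_nonneg _).trans (hBessel ((2 * i + 1) * (N + 1)))
      intro m hm
      obtain ⟨n, hn, rfl⟩ := Finset.mem_image.1 hm
      rw [Finset.mem_range] at hn ⊢
      nlinarith
    have h3 := sum_one_div_succ_sq_le N
    calc ∑ n ∈ Finset.range N, |c (2 * i * (n + 1) + n)| / ((n : ℝ) + 1)
        ≤ ∑ n ∈ Finset.range N, ((c (2 * i * (n + 1) + n)) ^ 2 / M + M / ((n : ℝ) + 1) ^ 2) / 2 := h1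
      _ = 1 / (2 * M) * (∑ n ∈ Finset.range N, (c (2 * i * (n + 1) + n)) ^ 2) +
            M / 2 * ∑ n ∈ Finset.range N, 1 / ((n : ℝ) + 1) ^ 2 := by
          rw [Finset.mul_sum, Finset.mul_sum, ← Finset.sum_add_distrib]
          exact Finset.sum_congr rfl fun n _ => by ring
      _ ≤ 1 / (2 * M) * (π ^ 2 / 2 * M ^ 2) + M / 2 * (π ^ 2 / 6) := by
          gcongr
      _ = π ^ 2 / 3 * M := by field_simp; ring
  -- per level: `(1∕(n+1))|T_{n+1}| ≤ (4∕π) Σ_i (1∕(2i+1)²)·|c_{(2i+1)(n+1)}|∕(n+1)`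
  have hlevel : ∀ n : ℕ, 1 / ((n : ℝ) + 1) *
      |∫ θ in (0 : ℝ)..π, f θ * (Real.arccos (Real.cos (((n : ℝ) + 1) * θ)) - π / 2)| ≤
        4 / π * ∑' i : ℕ, 1 / (2 * (i : ℝ) + 1) ^ 2 * (|c (2 * i * (n + 1) + n)| / ((n : ℝ) + 1)) := by
    intro n
    have h := abs_integral_mul_triangle_le_tsum hf hb ((n : ℝ) + 1)
    simp_rw [hfreq] at h
    have hs : Summable fun i : ℕ => |c (2 * i * (n + 1) + n)| / (2 * (i : ℝ) + 1) ^ 2 := by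
      refine Summable.of_nonneg_of_le (fun i => by positivity) (fun i => ?_) (hasSum_one_div_odd_sq.summable.mul_left (π * M))
      rw [div_eq_mul_one_div]
      refine mul_le_mul_of_nonneg_right ?_ (by positivity)
      have := abs_integral_mul_cos_le hb ((2 * i + 1) * ((n : ℝ) + 1))
      rw [← hfreq]
      refine le_trans (le_of_eq ?_) this
      congr 1
      exact intervalIntegral.integral_congr fun θ _ => by rw [mul_assoc]
    calc 1 / ((n : ℝ) + 1) * |∫ θ in (0 : ℝ)..π, f θ * (Real.arccos (Real.cos (((n : ℝ) + 1) * θ)) - π / 2)|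
        ≤ 1 / ((n : ℝ) + 1) * (4 / π * ∑' i : ℕ, |c (2 * i * (n + 1) + n)| / (2 * (i : ℝ) + 1) ^ 2) := by
          exact mul_le_mul_of_nonneg_left h (by positivity)
      _ = 4 / π * ∑' i : ℕ, 1 / (2 * (i : ℝ) + 1) ^ 2 * (|c (2 * i * (n + 1) + n)| / ((n : ℝ) + 1)) := by
          rw [← mul_assoc, mul_comm (1 / ((n : ℝ) + 1)), mul_assoc, ← tsum_mul_left]
          congr 1
          exact tsum_congr fun i => by ring
  -- summability of the level families in `i`, and their sum over `n`
  have hsi : ∀ n : ℕ, Summable fun i : ℕ => 1 / (2 * (i : ℝ) + 1) ^ 2 * (|c (2 * i * (n + 1) + n)| / ((n : ℝ) + 1)) :=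
    fun n => by
      refine Summable.of_nonneg_of_le (fun i => by positivity) (fun i => ?_)
        (hasSum_one_div_odd_sq.summable.mul_right (π * M / ((n : ℝ) + 1)))
      refine mul_le_mul_of_nonneg_left (div_le_div_of_nonneg_right ?_ (by positivity)) (by positivity)
      have := abs_integral_mul_cos_le hb ((((2 * i * (n + 1) + n : ℕ) : ℝ) + 1))
      simpa only [hc] using this
  calc ∑ n ∈ Finset.range N, 1 / ((n : ℝ) + 1) *
          |∫ θ in (0 : ℝ)..π, f θ * (Real.arccos (Real.cos (((n : ℝ) + 1) * θ)) - π / 2)|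
      ≤ ∑ n ∈ Finset.range N, 4 / π * ∑' i : ℕ, 1 / (2 * (i : ℝ) + 1) ^ 2 * (|c (2 * i * (n + 1) + n)| / ((n : ℝ) + 1)) :=
        Finset.sum_le_sum fun n _ => hlevel n
    _ = 4 / π * ∑' i : ℕ, ∑ n ∈ Finset.range N, 1 / (2 * (i : ℝ) + 1) ^ 2 * (|c (2 * i * (n + 1) + n)| / ((n : ℝ) + 1)) := by
        rw [← Finset.mul_sum, Summable.tsum_finsetSum fun n _ => hsi n]
    _ = 4 / π * ∑' i : ℕ, 1 / (2 * (i : ℝ) + 1) ^ 2 * ∑ n ∈ Finset.range N, |c (2 * i * (n + 1) + n)| / ((n : ℝ) + 1) := by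
        congr 1
        exact tsum_congr fun i => by rw [Finset.mul_sum]
    _ ≤ 4 / π * ∑' i : ℕ, 1 / (2 * (i : ℝ) + 1) ^ 2 * (π ^ 2 / 3 * M) := by
        refine mul_le_mul_of_nonneg_left ?_ (by positivity)
        refine Summable.tsum_le_tsum (fun i => mul_le_mul_of_nonneg_left (hinner i) (by positivity)) ?_
          (hasSum_one_div_odd_sq.summable.mul_right _)
        exact Summable.of_nonneg_of_le (fun i => mul_nonneg (by positivity) (Finset.sum_nonneg fun n _ => by positivity))
          (fun i => mul_le_mul_of_nonneg_left (hinner i) (by positivity)) (hasSum_one_div_odd_sq.summable.mul_right _)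
    _ = 4 / π * (π ^ 2 / 8 * (π ^ 2 / 3 * M)) := by rw [tsum_mul_right, hasSum_one_div_odd_sq.tsum_eq]
    _ = π ^ 3 / 6 * M := by field_simp; ring

/-- ★★ Summable form of the square-function bound: the level series converges absolutely with sum `≤ (π³∕6)M`. [folklore] -/
theorem summable_div_abs_integral_mul_triangle {f : ℝ → ℝ} {M : ℝ} (hf : Measurable f) (hM : 0 < M)
    (hb : ∀ θ, |f θ| ≤ M) :
    Summable (fun n : ℕ => 1 / ((n : ℝ) + 1) *
        |∫ θ in (0 : ℝ)..π, f θ * (Real.arccos (Real.cos (((n : ℝ) + 1) * θ)) - π / 2)|) ∧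
      ∑' n : ℕ, 1 / ((n : ℝ) + 1) *
        |∫ θ in (0 : ℝ)..π, f θ * (Real.arccos (Real.cos (((n : ℝ) + 1) * θ)) - π / 2)| ≤ π ^ 3 / 6 * M :=
  ⟨summable_of_sum_range_le (fun n => by positivity) (sum_div_abs_integral_mul_triangle_le hf hM hb),
    Real.tsum_le_of_sum_range_le (fun n => by positivity) (sum_div_abs_integral_mul_triangle_le hf hM hb)⟩

end Summit.QuantumFields.YangMills.Theorems.BalabanUVNodesN19TriangleWaveSquareFunction

end
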